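import Literature.MathematicalPhysics.QuantumFieldTheory.Balaban1983to89.T4HaarSU2LocalDiffeo

/-!
# Route `UnitScaleTilt` — crux K1bR-pr `FluctuationComparisonRegPr` (stmt-QuantumFields-19201), «Lemma B» line, step S-B2a:
# A PARAMETRIC INVERSE FUNCTION THEOREM ON `SU(2)` IN THE CONE PICTURE, MEASURE FORM — robust local surjectivity and reverse
# absolute continuity of a one-variable law from a STRICT JOINT DERIVATIVE (support file `--supports stmt-QuantumFields-19201`)

Fleet lead `ym-ust-19201-p1` (gen 0).  The fibrewise submersion engine (`FibrewiseSubmersion.isOpen_image_and_measureOpen_of_fibrewise`,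
p443878) asks, at every configuration `V₀` of the region and for the one-variable laws `f^U : SU(2) → SU(2)` of the averaging in the private
bond variable (environment `U` near `V₀`): an open `W ∋ f^{V₀}(g₀)` and a set `B ∋ g₀` inside any prescribed neighbourhood with, for EVERY `U`
near `V₀`, `W ⊆ f^U(B)` (ROBUST LOCAL SURJECTIVITY) and `Haar|_W ≪ (f^U)_*(Haar|_B)` (REVERSE ABSOLUTE CONTINUITY).  THIS FILE proves exactly
that for a family `K e : SU(2) → SU(2)` parametrised by a point `e` of a real normed space `Env`, from ONE analytic datum: a map `Φ : Env × ℍ → ℍ`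
which, for `e` near `e₀` and `x` in the open cone over an open `S ∋ g₀`, IS THE CONE EXTENSION `Φ(e, x) = ‖x‖ • su2Quat (K e (quatToSU2 x))` of
`K e` (quaternion model of `T4HaarSU2Translate`/`T4HaarSU2LocalDiffeo`), is differentiable there in `x`, and has a STRICT Fréchet derivative
`L` at `(e₀, su2Quat g₀)` JOINTLY in `(e, x)` whose `ℍ`-part `L ∘ inr` is invertible (**`su2_fibrewise_of_hasStrictFDerivAt`**).

THE ARGUMENT.  A strict joint derivative approximates `Φ` to any slope `c` on a neighbourhood of `(e₀, u₀)`
(`HasStrictFDerivAt.approximates_deriv_on_nhds`); along the fibres `{e} × ℍ` this says that `Φ(e, ·)` approximates the INVERTIBLE `D = L ∘ inr`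
on a ball `closedBall u₀ ρ`, uniformly for `e` near `e₀`; hence (`ApproximatesLinearOn.surjOn_closedBall_of_nonlinearRightInverse`, `c = ‖D⁻¹‖⁻¹/2`)
`Φ(e, ·)(closedBall u₀ ρ) ⊇ closedBall (Φ(e, u₀)) (cρ) ⊇ ball (Φ(e₀, u₀)) (cρ/2)` once `Φ(e, u₀)` is `cρ/2`-close to `Φ(e₀, u₀)`.  Reading unit
quaternions back in `SU(2)` (a value of norm one of the cone extension comes from a UNIT argument) gives `W ⊆ K e (B)` with
`W = su2Quat⁻¹(ball)`, `B = {g ∈ S ∩ B₁ : su2Quat g ∈ closedBall u₀ ρ}`.  Reverse absolute continuity: a Haar-null measurable `Z ⊆ B` has a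
Lebesgue-null cone (`volume_preimage_quatToSU2_null`); the cone over `K e (Z) ∩ W` is the image of (a part of) that cone under the differentiable
`Φ(e, ·)`, hence Lebesgue-null (`addHaar_image_eq_zero_of_differentiableOn_of_addHaar_eq_zero`, Lusin's property (N)); so `K e (Z) ∩ W`-supersets
of the form `W ∩ N` are Haar-null (`haar_null_of_volume_preimage_null`).  Every declaration is [folklore] calculus / measure theory; nothing of
Bałaban's is asserted.  Consumer: S-B2b instantiates `Φ` with the cone extension of the exp-mean-log fibre map `W ↦ exp(Σ_k |I|⁻¹ log(h_k W*))·W`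
of (0.4) (`T4EMLFibreAC.kf`), `e = ` (the frozen holonomies, `pre`, `post`).
-/

noncomputable section

open MeasureTheory Set Metric Function Filter
open scoped RealInnerProductSpace Topology NNReal Quaternion

namespace Summit.QuantumFields.YangMills.Theorems.SU2ParametricSubmersion

open Literature.MathematicalPhysics.QuantumFieldTheory (haarProbability)
open Literature.MathematicalPhysics.QuantumLattice (su2Quat norm_su2Quat quatToSU2 quatToSU2_su2Quat measurable_quatToSU2
  continuousOn_quatToSU2 quatToSU2_smul)
open Literature.MathematicalPhysics.QuantumFieldTheory.Balaban1983to89.T4HaarSU2Translate (su2Quat_quatToSU2 continuous_su2Quat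
  measurable_su2Quat haar_null_of_volume_preimage_null volume_preimage_quatToSU2_null)

variable {Env : Type*} [NormedAddCommGroup Env] [NormedSpace ℝ Env]

/-- Along a fibre `{e} × ℍ` a joint linear approximation is a linear approximation by the `ℍ`-part `L ∘ inr`, with the same slope
(the product norm is the sup norm). [folklore] -/
theorem approximatesLinearOn_fibre {Φ : Env × ℍ → ℍ} {L : Env × ℍ →L[ℝ] ℍ} {s : Set (Env × ℍ)} {c : ℝ≥0}
    (h : ApproximatesLinearOn Φ L s c) (e : Env) {t : Set ℍ} (ht : ∀ x ∈ t, (e, x) ∈ s) :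
    ApproximatesLinearOn (fun x => Φ (e, x)) (L.comp (ContinuousLinearMap.inr ℝ Env ℍ)) t c := by
  intro x hx y hy
  have key := h (e, x) (ht x hx) (e, y) (ht y hy)
  have hsub : ((e, x) : Env × ℍ) - (e, y) = ((0 : Env), x - y) := by
    rw [Prod.mk_sub_mk, sub_self]
  have hnorm : ‖(((0 : Env), x - y) : Env × ℍ)‖ = ‖x - y‖ := by
    rw [Prod.norm_mk, norm_zero, max_eq_right (norm_nonneg _)]
  rw [hsub, hnorm] at key
  simpa only [ContinuousLinearMap.coe_comp, Function.comp_apply, ContinuousLinearMap.inr_apply] using key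

/-- A value of norm one of a cone extension `x ↦ ‖x‖ • su2Quat (K (quatToSU2 x))` comes from an argument of norm one. [folklore] -/
theorem norm_eq_one_of_coneExt {K : Matrix.specialUnitaryGroup (Fin 2) ℂ → Matrix.specialUnitaryGroup (Fin 2) ℂ} {x z : ℍ}
    (hz : ‖z‖ = 1) (h : z = ‖x‖ • su2Quat (K (quatToSU2 x))) : ‖x‖ = 1 := by
  have := congrArg norm h
  rw [hz, norm_smul, norm_norm, norm_su2Quat, mul_one] at this
  exact this.symm

/-- **PARAMETRIC INVERSE FUNCTION THEOREM ON `SU(2)`, MEASURE FORM.**  Let `S ⊆ SU(2)` be open, `g₀ ∈ S`, `K e : SU(2) → SU(2)` measurable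
(`e ∈ Env`, a real normed space), and `Φ : Env × ℍ → ℍ` such that for `e` near `e₀`: `Φ(e, x) = ‖x‖ • su2Quat (K e (quatToSU2 x))` and
`Φ(e, ·)` is differentiable at `x`, for every `x ≠ 0` with `quatToSU2 x ∈ S`; and `Φ` has a STRICT derivative `L` at `(e₀, su2Quat g₀)` whose
`ℍ`-part is an isomorphism `D`.  Then for every open `B₁ ∋ g₀` there are a neighbourhood `𝒰` of `e₀`, a set `B` with `g₀ ∈ B ⊆ B₁` and an open
`W ∋ K e₀ g₀` such that for EVERY `e ∈ 𝒰`: `W ⊆ K e (B)` and `Haar|_W ≪ (K e)_*(Haar|_B)`. [folklore] -/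
theorem su2_fibrewise_of_hasStrictFDerivAt
    {S : Set (Matrix.specialUnitaryGroup (Fin 2) ℂ)} (hS : IsOpen S)
    {K : Env → Matrix.specialUnitaryGroup (Fin 2) ℂ → Matrix.specialUnitaryGroup (Fin 2) ℂ} (hKm : ∀ e, Measurable (K e))
    {Φ : Env × ℍ → ℍ} {L : Env × ℍ →L[ℝ] ℍ} {e₀ : Env} {g₀ : Matrix.specialUnitaryGroup (Fin 2) ℂ} (hg₀ : g₀ ∈ S)
    (hΦ : HasStrictFDerivAt Φ L (e₀, su2Quat g₀))
    (D : ℍ ≃L[ℝ] ℍ) (hD : (D : ℍ →L[ℝ] ℍ) = L.comp (ContinuousLinearMap.inr ℝ Env ℍ))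
    (hrep : ∀ᶠ e in 𝓝 e₀, ∀ x : ℍ, x ≠ 0 → quatToSU2 x ∈ S → Φ (e, x) = ‖x‖ • su2Quat (K e (quatToSU2 x)))
    (hdiff : ∀ᶠ e in 𝓝 e₀, ∀ x : ℍ, x ≠ 0 → quatToSU2 x ∈ S → DifferentiableAt ℝ (fun y => Φ (e, y)) x) :
    ∀ B₁ : Set (Matrix.specialUnitaryGroup (Fin 2) ℂ), IsOpen B₁ → g₀ ∈ B₁ →
      ∃ 𝒰 ∈ 𝓝 e₀, ∃ B W : Set (Matrix.specialUnitaryGroup (Fin 2) ℂ), g₀ ∈ B ∧ B ⊆ B₁ ∧ IsOpen W ∧ K e₀ g₀ ∈ W ∧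
        ∀ e ∈ 𝒰, W ⊆ K e '' B ∧
          (haarProbability (Matrix.specialUnitaryGroup (Fin 2) ℂ)).restrict W ≪
            ((haarProbability (Matrix.specialUnitaryGroup (Fin 2) ℂ)).restrict B).map (K e) := by
  intro B₁ hB₁ hg₀B₁
  letI : MeasurableSpace ℍ := Literature.Analysis.FluidPDE.Tao2016.quatMeasurableSpace
  haveI : BorelSpace ℍ := Literature.Analysis.FluidPDE.Tao2016.quatBorelSpace
  haveI := Literature.MathematicalPhysics.QuantumLattice.secondCountableTopology_su2
  set u₀ : ℍ := su2Quat g₀ with hu₀_def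
  have hu₀ : ‖u₀‖ = 1 := norm_su2Quat g₀
  have hu₀0 : u₀ ≠ 0 := fun h => by rw [h, norm_zero] at hu₀; exact zero_ne_one hu₀
  have hqu₀ : quatToSU2 u₀ = g₀ := quatToSU2_su2Quat g₀
  -- the open cone over `S ∩ B₁`
  set C : Set ℍ := {(0 : ℍ)}ᶜ ∩ quatToSU2 ⁻¹' (S ∩ B₁) with hC_def
  have hC : IsOpen C := continuousOn_quatToSU2.isOpen_inter_preimage isOpen_compl_singleton (hS.inter hB₁)
  have hu₀C : u₀ ∈ C := ⟨hu₀0, by rw [Set.mem_preimage, hqu₀]; exact ⟨hg₀, hg₀B₁⟩⟩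
  -- the slope
  have hsymm_pos : 0 < ‖(D.symm : ℍ →L[ℝ] ℍ)‖₊ := D.symm.norm_pos
  set c : ℝ≥0 := ‖(D.symm : ℍ →L[ℝ] ℍ)‖₊⁻¹ / 2 with hc_def
  have hc : 0 < c := by rw [hc_def]; positivity
  have hcc : ((‖(D.symm : ℍ →L[ℝ] ℍ)‖₊ : ℝ))⁻¹ - c = c := by
    rw [hc_def]; push_cast; ring
  -- strict differentiability: `Φ` approximates `L` with slope `c` near `(e₀, u₀)`
  obtain ⟨s, hs, happrox⟩ := hΦ.approximates_deriv_on_nhds (Or.inr hc)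
  obtain ⟨s₁, hs₁, s₂, hs₂, hprod⟩ := mem_nhds_prod_iff.mp hs
  -- a closed ball around `u₀` inside `s₂ ∩ C`
  obtain ⟨ε, hε, hεsub⟩ := Metric.mem_nhds_iff.mp (Filter.inter_mem hs₂ (hC.mem_nhds hu₀C))
  set ρ : ℝ := ε / 2 with hρ_def
  have hρ : 0 < ρ := by positivity
  have hball : closedBall u₀ ρ ⊆ s₂ ∩ C := (closedBall_subset_ball (by linarith)).trans hεsub
  -- continuity of `e ↦ Φ (e, u₀)` at `e₀`
  have hcont : Tendsto (fun e => Φ (e, u₀)) (𝓝 e₀) (𝓝 (Φ (e₀, u₀))) :=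
    hΦ.continuousAt.tendsto.comp ((continuous_id.prodMk continuous_const).tendsto e₀)
  set r : ℝ := (c : ℝ) * ρ with hr_def
  have hr : 0 < r := mul_pos (by exact_mod_cast hc) hρ
  have hnear : ∀ᶠ e in 𝓝 e₀, dist (Φ (e, u₀)) (Φ (e₀, u₀)) < r / 2 := Metric.tendsto_nhds.mp hcont (r / 2) (by positivity)
  -- the neighbourhood of the environment
  set 𝒰 : Set Env := s₁ ∩ {e | (∀ x : ℍ, x ≠ 0 → quatToSU2 x ∈ S → Φ (e, x) = ‖x‖ • su2Quat (K e (quatToSU2 x))) ∧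
      (∀ x : ℍ, x ≠ 0 → quatToSU2 x ∈ S → DifferentiableAt ℝ (fun y => Φ (e, y)) x) ∧
      dist (Φ (e, u₀)) (Φ (e₀, u₀)) < r / 2} with h𝒰_def
  have h𝒰 : 𝒰 ∈ 𝓝 e₀ := Filter.inter_mem hs₁ ((hrep.and hdiff).and hnear |>.mono fun e he => ⟨he.1.1, he.1.2, he.2⟩)
  -- the sets
  set B : Set (Matrix.specialUnitaryGroup (Fin 2) ℂ) := (S ∩ B₁) ∩ su2Quat ⁻¹' closedBall u₀ ρ with hB_def
  set W : Set (Matrix.specialUnitaryGroup (Fin 2) ℂ) := su2Quat ⁻¹' ball (Φ (e₀, u₀)) (r / 2) with hW_def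
  have hBm : MeasurableSet B :=
    ((hS.inter hB₁).measurableSet).inter (measurable_su2Quat measurableSet_closedBall)
  have hWo : IsOpen W := continuous_su2Quat.isOpen_preimage _ isOpen_ball
  have hrep₀ : Φ (e₀, u₀) = su2Quat (K e₀ g₀) := by
    rw [hrep.self_of_nhds u₀ hu₀0 (by rw [hqu₀]; exact hg₀), hu₀, one_smul, hqu₀]
  -- fibrewise facts for an environment `e ∈ 𝒰`
  have main : ∀ e ∈ 𝒰, ∀ z ∈ ball (Φ (e₀, u₀)) (r / 2), ‖z‖ = 1 →
      ∃ x ∈ closedBall u₀ ρ, ‖x‖ = 1 ∧ Φ (e, x) = z ∧ z = su2Quat (K e (quatToSU2 x)) ∧ quatToSU2 x ∈ B := by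
    intro e he z hz hz1
    have hfib : ApproximatesLinearOn (fun x => Φ (e, x)) (D : ℍ →L[ℝ] ℍ) (closedBall u₀ ρ) c := by
      rw [hD]
      exact approximatesLinearOn_fibre happrox e fun x hx => hprod ⟨he.1, (hball hx).1⟩
    have hsurj := hfib.surjOn_closedBall_of_nonlinearRightInverse D.toNonlinearRightInverse hρ.le Subset.rfl
    have hnn : (D.toNonlinearRightInverse).nnnorm = ‖(D.symm : ℍ →L[ℝ] ℍ)‖₊ := rfl
    rw [hnn, hcc] at hsurj
    have hzmem : z ∈ closedBall (Φ (e, u₀)) ((c : ℝ) * ρ) := by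
      rw [mem_closedBall]
      have h1 : dist z (Φ (e₀, u₀)) < r / 2 := mem_ball.mp hz
      have h2 : dist (Φ (e, u₀)) (Φ (e₀, u₀)) < r / 2 := he.2.2.2
      have := dist_triangle z (Φ (e₀, u₀)) (Φ (e, u₀))
      rw [dist_comm (Φ (e₀, u₀))] at this
      linarith
    obtain ⟨x, hx, hxz⟩ := hsurj hzmem
    have hxC : x ∈ C := (hball hx).2
    have hrepx : Φ (e, x) = ‖x‖ • su2Quat (K e (quatToSU2 x)) := he.2.1 x hxC.1 hxC.2.1
    have hx1 : ‖x‖ = 1 := norm_eq_one_of_coneExt hz1 (by rw [← hrepx]; exact hxz.symm)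
    have hzK : z = su2Quat (K e (quatToSU2 x)) := by rw [← hxz]; show Φ (e, x) = _; rw [hrepx, hx1, one_smul]
    refine ⟨x, hx, hx1, hxz, hzK, ⟨hxC.2, ?_⟩⟩
    show su2Quat (quatToSU2 x) ∈ closedBall u₀ ρ
    rw [su2Quat_quatToSU2 hxC.1, hx1, inv_one, one_smul]
    exact hx
  refine ⟨𝒰, h𝒰, B, W, ⟨⟨hg₀, hg₀B₁⟩, ?_⟩, fun g hg => hg.1.2, hWo, ?_, fun e he => ⟨?_, ?_⟩⟩
  · show su2Quat g₀ ∈ closedBall u₀ ρ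
    exact mem_closedBall_self hρ.le
  · show su2Quat (K e₀ g₀) ∈ ball (Φ (e₀, u₀)) (r / 2)
    rw [← hrep₀]; exact mem_ball_self (by positivity)
  · -- robust local surjectivity
    intro g hg
    obtain ⟨x, -, -, -, hzK, hxB⟩ := main e he (su2Quat g) hg (norm_su2Quat g)
    refine ⟨quatToSU2 x, hxB, ?_⟩
    have := congrArg quatToSU2 hzK
    rwa [quatToSU2_su2Quat, quatToSU2_su2Quat, eq_comm] at this
  · -- reverse absolute continuity through the cone picture
    refine Measure.AbsolutelyContinuous.mk fun N hN hN0 => ?_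
    rw [Measure.map_apply (hKm e) hN, Measure.restrict_apply ((hKm e) hN)] at hN0
    set Z : Set (Matrix.specialUnitaryGroup (Fin 2) ℂ) := K e ⁻¹' N ∩ B with hZ_def
    have hZm : MeasurableSet Z := ((hKm e) hN).inter hBm
    have hvZ : (volume : Measure ℍ) (quatToSU2 ⁻¹' Z) = 0 := volume_preimage_quatToSU2_null hZm hN0
    -- the part of the cone over `Z` above the ball
    set T : Set ℍ := {y | y ≠ 0 ∧ ‖y‖⁻¹ • y ∈ closedBall u₀ ρ ∧ quatToSU2 y ∈ Z} with hT_def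
    have hTC : T ⊆ C := by
      rintro y ⟨hy0, hyb, -⟩
      have hproj : quatToSU2 (‖y‖⁻¹ • y) = quatToSU2 y := quatToSU2_smul (inv_pos.mpr (norm_pos_iff.mpr hy0)) y
      refine ⟨hy0, ?_⟩
      show quatToSU2 y ∈ S ∩ B₁
      rw [← hproj]; exact ((hball hyb).2).2
    have hvT : (volume : Measure ℍ) T = 0 := measure_mono_null (fun y hy => hy.2.2) hvZ
    have hdiffT : DifferentiableOn ℝ (fun y => Φ (e, y)) T :=
      fun y hy => (he.2.2.1 y (hTC hy).1 (hTC hy).2.1).differentiableWithinAt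
    have himg : (volume : Measure ℍ) ((fun y => Φ (e, y)) '' T) = 0 :=
      addHaar_image_eq_zero_of_differentiableOn_of_addHaar_eq_zero volume hdiffT hvT
    -- the cone over `W ∩ N` lies in `{0} ∪ Φ(e, ·)(T)`
    have hsub : quatToSU2 ⁻¹' (N ∩ W) ⊆ {(0 : ℍ)} ∪ (fun y => Φ (e, y)) '' T := by
      intro y hy
      by_cases hy0 : y = 0
      · exact Or.inl hy0
      refine Or.inr ?_
      obtain ⟨hyN, hyW⟩ := hy
      obtain ⟨x, hx, hx1, hxz, hzK, hxB⟩ := main e he _ hyW (norm_su2Quat _)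
      have hgx : quatToSU2 y = K e (quatToSU2 x) := by
        have := congrArg quatToSU2 hzK
        rwa [quatToSU2_su2Quat, quatToSU2_su2Quat] at this
      have hny : 0 < ‖y‖ := norm_pos_iff.mpr hy0
      have hx0 : x ≠ 0 := fun h => by rw [h, norm_zero] at hx1; exact zero_ne_one hx1
      refine ⟨‖y‖ • x, ⟨smul_ne_zero hny.ne' hx0, ?_, ?_⟩, ?_⟩
      · rw [norm_smul, norm_norm, hx1, mul_one, smul_smul, inv_mul_cancel₀ hny.ne', one_smul]
        exact hx
      · show quatToSU2 (‖y‖ • x) ∈ Z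
        rw [quatToSU2_smul hny]
        exact ⟨show K e (quatToSU2 x) ∈ N by rw [← hgx]; exact hyN, hxB⟩
      · have hyxC : ‖y‖ • x ∈ C := by
          refine ⟨smul_ne_zero hny.ne' hx0, ?_⟩
          show quatToSU2 (‖y‖ • x) ∈ S ∩ B₁
          rw [quatToSU2_smul hny]; exact hxB.1
        show Φ (e, ‖y‖ • x) = y
        rw [he.2.1 _ hyxC.1 hyxC.2.1, quatToSU2_smul hny, ← hgx, su2Quat_quatToSU2 hy0, norm_smul, norm_norm, hx1,
          mul_one, smul_smul, mul_inv_cancel₀ hny.ne', one_smul]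
    have hvol : (volume : Measure ℍ) (quatToSU2 ⁻¹' (N ∩ W)) = 0 :=
      measure_mono_null hsub (measure_union_null (measure_singleton _) himg)
    rw [Measure.restrict_apply hN]
    exact haar_null_of_volume_preimage_null (hN.inter hWo.measurableSet) hvol

/-- **PARAMETRIC INVERSE FUNCTION THEOREM ON `SU(2)`, MEASURE FORM — INDEXED ENVIRONMENTS.**  The same as
`su2_fibrewise_of_hasStrictFDerivAt` for a family `K t : SU(2) → SU(2)` indexed by a point `t` of a topological space `T` that enters the
analytic datum `Φ : Env × ℍ → ℍ` through a map `η : T → Env` continuous at `t₀` (in the application `t` is a lattice configuration and `η t`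
its frozen holonomies read as quaternions): for `t` near `t₀` and `x` in the cone over `S`, `Φ(η t, x) = ‖x‖ • su2Quat (K t (quatToSU2 x))`.
[folklore] -/
theorem su2_fibrewise_of_hasStrictFDerivAt' {T : Type*} [TopologicalSpace T]
    {S : Set (Matrix.specialUnitaryGroup (Fin 2) ℂ)} (hS : IsOpen S)
    {K : T → Matrix.specialUnitaryGroup (Fin 2) ℂ → Matrix.specialUnitaryGroup (Fin 2) ℂ} (hKm : ∀ t, Measurable (K t))
    {η : T → Env} {t₀ : T} (hη : ContinuousAt η t₀)
    {Φ : Env × ℍ → ℍ} {L : Env × ℍ →L[ℝ] ℍ} {g₀ : Matrix.specialUnitaryGroup (Fin 2) ℂ} (hg₀ : g₀ ∈ S)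
    (hΦ : HasStrictFDerivAt Φ L (η t₀, su2Quat g₀))
    (D : ℍ ≃L[ℝ] ℍ) (hD : (D : ℍ →L[ℝ] ℍ) = L.comp (ContinuousLinearMap.inr ℝ Env ℍ))
    (hrep : ∀ᶠ t in 𝓝 t₀, ∀ x : ℍ, x ≠ 0 → quatToSU2 x ∈ S → Φ (η t, x) = ‖x‖ • su2Quat (K t (quatToSU2 x)))
    (hdiff : ∀ᶠ e in 𝓝 (η t₀), ∀ x : ℍ, x ≠ 0 → quatToSU2 x ∈ S → DifferentiableAt ℝ (fun y => Φ (e, y)) x) :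
    ∀ B₁ : Set (Matrix.specialUnitaryGroup (Fin 2) ℂ), IsOpen B₁ → g₀ ∈ B₁ →
      ∃ 𝒰 ∈ 𝓝 t₀, ∃ B W : Set (Matrix.specialUnitaryGroup (Fin 2) ℂ), g₀ ∈ B ∧ B ⊆ B₁ ∧ IsOpen W ∧ K t₀ g₀ ∈ W ∧
        ∀ t ∈ 𝒰, W ⊆ K t '' B ∧
          (haarProbability (Matrix.specialUnitaryGroup (Fin 2) ℂ)).restrict W ≪
            ((haarProbability (Matrix.specialUnitaryGroup (Fin 2) ℂ)).restrict B).map (K t) := by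
  intro B₁ hB₁ hg₀B₁
  letI : MeasurableSpace ℍ := Literature.Analysis.FluidPDE.Tao2016.quatMeasurableSpace
  haveI : BorelSpace ℍ := Literature.Analysis.FluidPDE.Tao2016.quatBorelSpace
  haveI := Literature.MathematicalPhysics.QuantumLattice.secondCountableTopology_su2
  set e₀ : Env := η t₀ with he₀_def
  set u₀ : ℍ := su2Quat g₀ with hu₀_def
  have hu₀ : ‖u₀‖ = 1 := norm_su2Quat g₀
  have hu₀0 : u₀ ≠ 0 := fun h => by rw [h, norm_zero] at hu₀; exact zero_ne_one hu₀
  have hqu₀ : quatToSU2 u₀ = g₀ := quatToSU2_su2Quat g₀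
  -- the open cone over `S ∩ B₁`
  set C : Set ℍ := {(0 : ℍ)}ᶜ ∩ quatToSU2 ⁻¹' (S ∩ B₁) with hC_def
  have hC : IsOpen C := continuousOn_quatToSU2.isOpen_inter_preimage isOpen_compl_singleton (hS.inter hB₁)
  have hu₀C : u₀ ∈ C := ⟨hu₀0, by rw [Set.mem_preimage, hqu₀]; exact ⟨hg₀, hg₀B₁⟩⟩
  -- the slope
  have hsymm_pos : 0 < ‖(D.symm : ℍ →L[ℝ] ℍ)‖₊ := D.symm.norm_pos
  set c : ℝ≥0 := ‖(D.symm : ℍ →L[ℝ] ℍ)‖₊⁻¹ / 2 with hc_def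
  have hc : 0 < c := by rw [hc_def]; positivity
  have hcc : ((‖(D.symm : ℍ →L[ℝ] ℍ)‖₊ : ℝ))⁻¹ - c = c := by
    rw [hc_def]; push_cast; ring
  -- strict differentiability: `Φ` approximates `L` with slope `c` near `(e₀, u₀)`
  obtain ⟨s, hs, happrox⟩ := hΦ.approximates_deriv_on_nhds (Or.inr hc)
  obtain ⟨s₁, hs₁, s₂, hs₂, hprod⟩ := mem_nhds_prod_iff.mp hs
  obtain ⟨ε, hε, hεsub⟩ := Metric.mem_nhds_iff.mp (Filter.inter_mem hs₂ (hC.mem_nhds hu₀C))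
  set ρ : ℝ := ε / 2 with hρ_def
  have hρ : 0 < ρ := by positivity
  have hball : closedBall u₀ ρ ⊆ s₂ ∩ C := (closedBall_subset_ball (by linarith)).trans hεsub
  -- continuity of `t ↦ Φ (η t, u₀)` at `t₀`
  have hcont : Tendsto (fun t => Φ (η t, u₀)) (𝓝 t₀) (𝓝 (Φ (e₀, u₀))) :=
    hΦ.continuousAt.tendsto.comp (hη.tendsto.prodMk_nhds tendsto_const_nhds)
  set r : ℝ := (c : ℝ) * ρ with hr_def
  have hr : 0 < r := mul_pos (by exact_mod_cast hc) hρ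
  have hnear : ∀ᶠ t in 𝓝 t₀, dist (Φ (η t, u₀)) (Φ (e₀, u₀)) < r / 2 := Metric.tendsto_nhds.mp hcont (r / 2) (by positivity)
  have hdiff' : ∀ᶠ t in 𝓝 t₀, ∀ x : ℍ, x ≠ 0 → quatToSU2 x ∈ S → DifferentiableAt ℝ (fun y => Φ (η t, y)) x :=
    hη.eventually hdiff
  have hs₁' : ∀ᶠ t in 𝓝 t₀, η t ∈ s₁ := hη.eventually (Filter.eventually_mem_set.mpr hs₁)
  -- the neighbourhood of the environment
  set 𝒰 : Set T := {t | η t ∈ s₁ ∧ (∀ x : ℍ, x ≠ 0 → quatToSU2 x ∈ S → Φ (η t, x) = ‖x‖ • su2Quat (K t (quatToSU2 x))) ∧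
      (∀ x : ℍ, x ≠ 0 → quatToSU2 x ∈ S → DifferentiableAt ℝ (fun y => Φ (η t, y)) x) ∧
      dist (Φ (η t, u₀)) (Φ (e₀, u₀)) < r / 2} with h𝒰_def
  have h𝒰 : 𝒰 ∈ 𝓝 t₀ := ((hs₁'.and hrep).and (hdiff'.and hnear)).mono fun t ht => ⟨ht.1.1, ht.1.2, ht.2.1, ht.2.2⟩
  -- the sets
  set B : Set (Matrix.specialUnitaryGroup (Fin 2) ℂ) := (S ∩ B₁) ∩ su2Quat ⁻¹' closedBall u₀ ρ with hB_def
  set W : Set (Matrix.specialUnitaryGroup (Fin 2) ℂ) := su2Quat ⁻¹' ball (Φ (e₀, u₀)) (r / 2) with hW_def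
  have hBm : MeasurableSet B :=
    ((hS.inter hB₁).measurableSet).inter (measurable_su2Quat measurableSet_closedBall)
  have hWo : IsOpen W := continuous_su2Quat.isOpen_preimage _ isOpen_ball
  have hrep₀ : Φ (e₀, u₀) = su2Quat (K t₀ g₀) := by
    rw [he₀_def, hrep.self_of_nhds u₀ hu₀0 (by rw [hqu₀]; exact hg₀), hu₀, one_smul, hqu₀]
  -- fibrewise facts for an environment `t ∈ 𝒰`
  have main : ∀ t ∈ 𝒰, ∀ z ∈ ball (Φ (e₀, u₀)) (r / 2), ‖z‖ = 1 →
      ∃ x ∈ closedBall u₀ ρ, ‖x‖ = 1 ∧ Φ (η t, x) = z ∧ z = su2Quat (K t (quatToSU2 x)) ∧ quatToSU2 x ∈ B := by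
    intro t ht z hz hz1
    have hfib : ApproximatesLinearOn (fun x => Φ (η t, x)) (D : ℍ →L[ℝ] ℍ) (closedBall u₀ ρ) c := by
      rw [hD]
      exact approximatesLinearOn_fibre happrox (η t) fun x hx => hprod ⟨ht.1, (hball hx).1⟩
    have hsurj := hfib.surjOn_closedBall_of_nonlinearRightInverse D.toNonlinearRightInverse hρ.le Subset.rfl
    have hnn : (D.toNonlinearRightInverse).nnnorm = ‖(D.symm : ℍ →L[ℝ] ℍ)‖₊ := rfl
    rw [hnn, hcc] at hsurj
    have hzmem : z ∈ closedBall (Φ (η t, u₀)) ((c : ℝ) * ρ) := by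
      rw [mem_closedBall]
      have h1 : dist z (Φ (e₀, u₀)) < r / 2 := mem_ball.mp hz
      have h2 : dist (Φ (η t, u₀)) (Φ (e₀, u₀)) < r / 2 := ht.2.2.2
      have := dist_triangle z (Φ (e₀, u₀)) (Φ (η t, u₀))
      rw [dist_comm (Φ (e₀, u₀))] at this
      linarith
    obtain ⟨x, hx, hxz⟩ := hsurj hzmem
    have hxC : x ∈ C := (hball hx).2
    have hrepx : Φ (η t, x) = ‖x‖ • su2Quat (K t (quatToSU2 x)) := ht.2.1 x hxC.1 hxC.2.1
    have hx1 : ‖x‖ = 1 := norm_eq_one_of_coneExt hz1 (by rw [← hrepx]; exact hxz.symm)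
    have hzK : z = su2Quat (K t (quatToSU2 x)) := by rw [← hxz]; show Φ (η t, x) = _; rw [hrepx, hx1, one_smul]
    refine ⟨x, hx, hx1, hxz, hzK, ⟨hxC.2, ?_⟩⟩
    show su2Quat (quatToSU2 x) ∈ closedBall u₀ ρ
    rw [su2Quat_quatToSU2 hxC.1, hx1, inv_one, one_smul]
    exact hx
  refine ⟨𝒰, h𝒰, B, W, ⟨⟨hg₀, hg₀B₁⟩, ?_⟩, fun g hg => hg.1.2, hWo, ?_, fun t ht => ⟨?_, ?_⟩⟩
  · show su2Quat g₀ ∈ closedBall u₀ ρ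
    exact mem_closedBall_self hρ.le
  · show su2Quat (K t₀ g₀) ∈ ball (Φ (e₀, u₀)) (r / 2)
    rw [← hrep₀]; exact mem_ball_self (by positivity)
  · -- robust local surjectivity
    intro g hg
    obtain ⟨x, -, -, -, hzK, hxB⟩ := main t ht (su2Quat g) hg (norm_su2Quat g)
    refine ⟨quatToSU2 x, hxB, ?_⟩
    have := congrArg quatToSU2 hzK
    rwa [quatToSU2_su2Quat, quatToSU2_su2Quat, eq_comm] at this
  · -- reverse absolute continuity through the cone picture
    refine Measure.AbsolutelyContinuous.mk fun N hN hN0 => ?_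
    rw [Measure.map_apply (hKm t) hN, Measure.restrict_apply ((hKm t) hN)] at hN0
    set Z : Set (Matrix.specialUnitaryGroup (Fin 2) ℂ) := K t ⁻¹' N ∩ B with hZ_def
    have hZm : MeasurableSet Z := ((hKm t) hN).inter hBm
    have hvZ : (volume : Measure ℍ) (quatToSU2 ⁻¹' Z) = 0 := volume_preimage_quatToSU2_null hZm hN0
    set Tc : Set ℍ := {y | y ≠ 0 ∧ ‖y‖⁻¹ • y ∈ closedBall u₀ ρ ∧ quatToSU2 y ∈ Z} with hTc_def
    have hTC : Tc ⊆ C := by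
      rintro y ⟨hy0, hyb, -⟩
      have hproj : quatToSU2 (‖y‖⁻¹ • y) = quatToSU2 y := quatToSU2_smul (inv_pos.mpr (norm_pos_iff.mpr hy0)) y
      refine ⟨hy0, ?_⟩
      show quatToSU2 y ∈ S ∩ B₁
      rw [← hproj]; exact ((hball hyb).2).2
    have hvT : (volume : Measure ℍ) Tc = 0 := measure_mono_null (fun y hy => hy.2.2) hvZ
    have hdiffT : DifferentiableOn ℝ (fun y => Φ (η t, y)) Tc :=
      fun y hy => (ht.2.2.1 y (hTC hy).1 (hTC hy).2.1).differentiableWithinAt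
    have himg : (volume : Measure ℍ) ((fun y => Φ (η t, y)) '' Tc) = 0 :=
      addHaar_image_eq_zero_of_differentiableOn_of_addHaar_eq_zero volume hdiffT hvT
    have hsub : quatToSU2 ⁻¹' (N ∩ W) ⊆ {(0 : ℍ)} ∪ (fun y => Φ (η t, y)) '' Tc := by
      intro y hy
      by_cases hy0 : y = 0
      · exact Or.inl hy0
      refine Or.inr ?_
      obtain ⟨hyN, hyW⟩ := hy
      obtain ⟨x, hx, hx1, hxz, hzK, hxB⟩ := main t ht _ hyW (norm_su2Quat _)
      have hgx : quatToSU2 y = K t (quatToSU2 x) := by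
        have := congrArg quatToSU2 hzK
        rwa [quatToSU2_su2Quat, quatToSU2_su2Quat] at this
      have hny : 0 < ‖y‖ := norm_pos_iff.mpr hy0
      have hx0 : x ≠ 0 := fun h => by rw [h, norm_zero] at hx1; exact zero_ne_one hx1
      refine ⟨‖y‖ • x, ⟨smul_ne_zero hny.ne' hx0, ?_, ?_⟩, ?_⟩
      · rw [norm_smul, norm_norm, hx1, mul_one, smul_smul, inv_mul_cancel₀ hny.ne', one_smul]
        exact hx
      · show quatToSU2 (‖y‖ • x) ∈ Z
        rw [quatToSU2_smul hny]
        exact ⟨show K t (quatToSU2 x) ∈ N by rw [← hgx]; exact hyN, hxB⟩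
      · have hyxC : ‖y‖ • x ∈ C := by
          refine ⟨smul_ne_zero hny.ne' hx0, ?_⟩
          show quatToSU2 (‖y‖ • x) ∈ S ∩ B₁
          rw [quatToSU2_smul hny]; exact hxB.1
        show Φ (η t, ‖y‖ • x) = y
        rw [ht.2.1 _ hyxC.1 hyxC.2.1, quatToSU2_smul hny, ← hgx, su2Quat_quatToSU2 hy0, norm_smul, norm_norm, hx1,
          mul_one, smul_smul, mul_inv_cancel₀ hny.ne', one_smul]
    have hvol : (volume : Measure ℍ) (quatToSU2 ⁻¹' (N ∩ W)) = 0 :=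
      measure_mono_null hsub (measure_union_null (measure_singleton _) himg)
    rw [Measure.restrict_apply hN]
    exact haar_null_of_volume_preimage_null (hN.inter hWo.measurableSet) hvol

end Summit.QuantumFields.YangMills.Theorems.SU2ParametricSubmersion

end
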